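import Literature.IUT.LogThetaLattice.PacketWeights
import HarnessLib

/-!
# [IUTchIII] Remark 3.1.1 (ii) at a product-of-ideals region of the `A`-fold tensor packet: the
# normalized weights CANCEL the determinant exponent — capsule log-volumes are ADDITIVE over labels
# with NO factor `d^{|A|-1}` (proof-only companion to `PacketWeights.lean`, abc-iut cell, layer L6)

S. Mochizuki, *Inter-universal Teichmüller theory III*, kurims manuscript (May 2020), §3, Remark 3.1.1
(ii) p. 94 (the normalized weights, typed by abc-iut-L6-t4 as `packetWeight` / `packetWeightTensor`),
(iv) p. 97 (weighted sums of log-volumes of direct product regions), Proposition 3.9 (i) p. 115 (the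
packet-normalization "multiplication … by `p_v` corresponds to adding the quantity `−log(p_v)`" for ALL
of `μ^log_{α,v_ℚ}`, `μ^log_{A,v_ℚ}`, `μ^log_{A,α,v}`). [claim: Mochizuki2012, status: disputed] for the
quoted conventions; the identities below are elementary finite sums.

THE COMPUTATION. Fix `v_ℚ` and index the places `v | v_ℚ` (≅ the places `w ∈ 𝕍_mod` over `v_ℚ`) by a
finite type `W`, with `degF w = [(F_mod)_w : ℚ_{v_ℚ}]`, `degKF w = [K_v : (F_mod)_v]`, so
`n_w := [K_v : ℚ_{v_ℚ}] = degKF w · degF w`. The `A`-fold tensor packet `⊗_{α∈A} (⊕_w K_w)` (over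
`ℚ_{v_ℚ}`) is the direct sum over `wA : A → W` of the portions `M_{wA} = ⊗_α K_{wA α}`, of
`ℚ_{v_ℚ}`-dimension `Π_α n_{wA α}`. For units `x_α ∈ ⊕_w K_w` (one per label), multiplication by
`x = ⊗_α x_α` on `M_{wA}` has `|det|_{p} = Π_α |N_{K_{wA α}/ℚ_{v_ℚ}}(x_{α, wA α})|^{Π_{β≠α} n_{wA β}}`
(determinant of `id ⊗ ⋯ ⊗ m_{x_α} ⊗ ⋯ ⊗ id`), so the Haar log-volume of the translate by `x` of a
reference region of `M_{wA}` changes by `Σ_α (Π_{β≠α} n_{wA β}) · t α (wA α)` with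
`t α w := log |N_{K_w/ℚ_{v_ℚ}}(x_{α,w})|` (`= c_{α,w} · log N𝔭_w` for `x_{α,w}𝒪_w = 𝔭_w^{-c_{α,w}}`). These
summand-wise changes are abstract reals `t : A → W → ℝ` below (no fields are needed for the bookkeeping).

* `sum_packetWeightTensor_mul_tensorDetChange` — with the PRINTED normalized tensor weights
  (`packetWeightTensor`, denominator `(Π_α degKF) · Σ_{{w_α}} Π_α degF = (Π_α degKF) · D^{|A|}`,
  `D = Σ_w degF w`, `PacketWeights.sum_prod_degF_eq_pow`) the weighted `A`-capsule change equals
  `Σ_α Σ_w packetWeight w · t α w` = the SUM over labels of the single-packet (`|A| = 1`) normalized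
  changes: the exponent `D^{|A|-1}` produced by the determinant is exactly cancelled by the normalisation.
* `sum_tensorDetChange_unweighted` — dropping the weights (plain Haar log-volume of the whole
  `(Σ_w n_w)^{|A|}`-dimensional packet) gives `(Σ_w n_w)^{|A|-1} · Σ_α Σ_w t α w` instead: this is where a
  factor `d^{|A|-1}` comes from if the weights of Remark 3.1.1 (ii) are omitted.
* `capsule_packetNormalized` — consequence: multiplying ONE label by `p_{v_ℚ}` (`t α₀ w = n_w · c`,
  `t α w = 0` for `α ≠ α₀`) changes the weighted `A`-capsule log-volume by exactly `c` (`= −log p_{v_ℚ}`),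
  for EVERY `A` — the printed packet-normalization of `μ^log_{A,v_ℚ}`, in the same unit as `μ^log_{α,v_ℚ}`.

Why filed (abc-iut-w4-d035, second-pass audit of `PacketLogVolumesCapsules.lean` p410592): that file's
divisor-level `capsuleLogVolume F A v_ℚ c := [F:ℚ]^{|A|-1} · Σ_α packetDivisorLogVolume F v_ℚ (c α)`
derives its constant `[F:ℚ]^{|A|-1}` from the UNWEIGHTED Haar scaling; relative to the printed weights the
`A`-capsule log-volume of `⊗_α 𝔞_α` is `Σ_α μ^log_{α,v_ℚ}(𝔞_α)` in the SAME unit as the single-label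
log-volume (constant `1` in that file's own `|A| = 1` units). Its typed `Prop39iii_degree` /
`Prop39iii_invariance` instances hold with either constant; what differs is the unit across capsule sizes
(procession averages over `j = 1, …, l^⋇` mix capsules of different sizes). Nothing here bears on
[IUTchIII] Cor. 3.12; no side is taken.
-/

namespace Literature.IUT.LogThetaLattice

open Finset

universe u v

section CapsuleAdditivity

variable {W : Type u} [Fintype W] {A : Type v} [Fintype A] [DecidableEq A]

/-- Positive naturals cast to nonzero reals. [folklore] -/
private lemma pnat_cast_ne_zero (n : ℕ+) : (n : ℝ) ≠ 0 := by
  exact_mod_cast n.ne_zero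

/-- The per-portion identity behind the cancellation ([IUTchIII] Rmk 3.1.1 (ii) p.94, third display):
`w_{wA} · (Π_{β≠α} n_{wA β}) · t = (Π_{β≠α} degF (wA β)) · t / (degKF (wA α) · S)` where
`w_{wA} = 1/((Π_γ degKF (wA γ)) · S)` is the normalized tensor weight with denominator sum `S` — the
`degKF`-factors of the labels `β ≠ α` cancel. [claim: Mochizuki2012, status: disputed] -/
theorem packetWeightTensor_mul_prod_erase (degF degKF : W → ℕ+) (wA : A → W) (α : A) (t : ℝ) :
    packetWeightTensor degF degKF wA *
        ((∏ β ∈ univ.erase α, ((degKF (wA β) : ℝ) * (degF (wA β) : ℝ))) * t) =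
      (∏ β ∈ univ.erase α, (degF (wA β) : ℝ)) * t /
        ((degKF (wA α) : ℝ) * ∑ w' : A → W, ∏ a, (degF (w' a) : ℝ)) := by
  unfold packetWeightTensor
  have hK : (∏ a, (degKF (wA a) : ℝ)) =
      (∏ β ∈ univ.erase α, (degKF (wA β) : ℝ)) * (degKF (wA α) : ℝ) :=
    (Finset.prod_erase_mul _ _ (Finset.mem_univ α)).symm
  have hKe : (∏ β ∈ univ.erase α, (degKF (wA β) : ℝ)) ≠ 0 :=
    Finset.prod_ne_zero_iff.mpr fun β _ => pnat_cast_ne_zero (degKF (wA β))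
  have hKα : (degKF (wA α) : ℝ) ≠ 0 := pnat_cast_ne_zero (degKF (wA α))
  rw [hK, Finset.prod_mul_distrib]
  by_cases hS : (∑ w' : A → W, ∏ a, (degF (w' a) : ℝ)) = 0
  · simp [hS]
  · field_simp

/-- Summing the portion terms over all portions `wA : A → W` for a fixed label `α`
([IUTchIII] Rmk 3.1.1 (ii)/(iv), pp.94–97): `Σ_{wA} (Π_{β≠α} degF (wA β)) · g (wA α) = D^{|A|-1} · Σ_w g w`,
`D = Σ_w degF w` (the factors `β ≠ α` range freely over `W`). [claim: Mochizuki2012, status: disputed] -/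
theorem sum_prod_erase_degF_mul (degF : W → ℕ+) (α : A) (g : W → ℝ) :
    ∑ wA : A → W, (∏ β ∈ univ.erase α, (degF (wA β) : ℝ)) * g (wA α) =
      (∑ w, (degF w : ℝ)) ^ (Fintype.card A - 1) * ∑ w, g w := by
  -- the integrand is the full product of `G β w := if β = α then g w else degF w`
  let G : A → W → ℝ := fun β w => if β = α then g w else (degF w : ℝ)
  have hGα : ∀ w, G α w = g w := fun w => by simp [G]
  have hGβ : ∀ β, β ≠ α → ∀ w, G β w = (degF w : ℝ) := fun β hβ w => by simp [G, hβ]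
  have hprod : ∀ wA : A → W,
      (∏ β ∈ univ.erase α, (degF (wA β) : ℝ)) * g (wA α) = ∏ β, G β (wA β) := by
    intro wA
    rw [← Finset.prod_erase_mul univ (fun β => G β (wA β)) (Finset.mem_univ α), hGα]
    congr 1
    exact Finset.prod_congr rfl fun β hβ => (hGβ β (Finset.ne_of_mem_erase hβ) (wA β)).symm
  have hsumβ : ∀ β, β ≠ α → (∑ w, G β w) = ∑ w, (degF w : ℝ) :=
    fun β hβ => Finset.sum_congr rfl fun w _ => hGβ β hβ w
  have hsumα : (∑ w, G α w) = ∑ w, g w := Finset.sum_congr rfl fun w _ => hGα w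
  calc ∑ wA : A → W, (∏ β ∈ univ.erase α, (degF (wA β) : ℝ)) * g (wA α)
      = ∑ wA : A → W, ∏ β, G β (wA β) := Finset.sum_congr rfl fun wA _ => hprod wA
    _ = ∏ β, ∑ w, G β w := (Fintype.prod_sum G).symm
    _ = (∏ β ∈ univ.erase α, ∑ w, G β w) * ∑ w, G α w :=
        (Finset.prod_erase_mul univ (fun β => ∑ w, G β w) (Finset.mem_univ α)).symm
    _ = (∏ β ∈ univ.erase α, ∑ w, (degF w : ℝ)) * ∑ w, g w := by
        rw [hsumα]
        congr 1
        exact Finset.prod_congr rfl fun β hβ => hsumβ β (Finset.ne_of_mem_erase hβ)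
    _ = (∑ w, (degF w : ℝ)) ^ (Fintype.card A - 1) * ∑ w, g w := by
        rw [Finset.prod_const, Finset.card_erase_of_mem (Finset.mem_univ α), Finset.card_univ]

/-- **Dropping the weights produces the factor `(Σ_w n_w)^{|A|-1}`** ([IUTchIII] Rmk 3.1.1 (ii)–(iv),
pp.94–97, contrapositive reading): the UNWEIGHTED sum over the portions of the determinant changes — i.e.
the plain Haar log-volume change of the whole `(Σ_w n_w)^{|A|}`-dimensional `ℚ_{v_ℚ}`-space — equals
`(Σ_w n_w)^{|A|-1} · Σ_α Σ_w t α w` (`n_w = degKF w · degF w`). This is the normalisation constant one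
obtains if the weights of Remark 3.1.1 (ii) are omitted. [claim: Mochizuki2012, status: disputed] -/
theorem sum_tensorDetChange_unweighted (degF degKF : W → ℕ+) (t : A → W → ℝ) :
    ∑ wA : A → W, ∑ α, (∏ β ∈ univ.erase α, ((degKF (wA β) : ℝ) * (degF (wA β) : ℝ))) * t α (wA α) =
      (∑ w, (degKF w : ℝ) * (degF w : ℝ)) ^ (Fintype.card A - 1) * ∑ α, ∑ w, t α w := by
  rw [Finset.sum_comm, Finset.mul_sum]
  refine Finset.sum_congr rfl fun α _ => ?_
  -- same free-product argument with the degrees `n_w = degKF w · degF w`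
  have h := sum_prod_erase_degF_mul (A := A) (fun w => degKF w * degF w) α (t α)
  simp only [PNat.mul_coe, Nat.cast_mul] at h
  exact h

/-- By contrast with `capsule_packetNormalized` below, the UNWEIGHTED change under multiplication of one
label by `p_{v_ℚ}` is `(Σ_w n_w)^{|A|} · c`, i.e. `[K : ℚ]^{|A|} · c` at the model — a unit that depends on
the capsule size ([IUTchIII] Rmk 3.1.1 (ii), p.94: the reason for the normalized weights).
[claim: Mochizuki2012, status: disputed] -/
theorem capsule_unweighted_not_normalized (degF degKF : W → ℕ+) (α₀ : A) (c : ℝ) :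
    ∑ wA : A → W, ∑ α, (∏ β ∈ univ.erase α, ((degKF (wA β) : ℝ) * (degF (wA β) : ℝ))) *
          (if α = α₀ then ((degKF (wA α) : ℝ) * (degF (wA α) : ℝ)) * c else 0) =
      (∑ w, (degKF w : ℝ) * (degF w : ℝ)) ^ Fintype.card A * c := by
  rw [sum_tensorDetChange_unweighted degF degKF
    (fun α w => if α = α₀ then ((degKF w : ℝ) * (degF w : ℝ)) * c else 0)]
  rw [Finset.sum_eq_single α₀ (fun α _ hα => by simp [hα]) (fun h => absurd (Finset.mem_univ α₀) h)]
  simp only [if_true, ← Finset.sum_mul]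
  have hcard : Fintype.card A = (Fintype.card A - 1) + 1 :=
    (Nat.sub_add_cancel (Fintype.card_pos_iff.mpr ⟨α₀⟩)).symm
  rw [hcard, pow_succ, Nat.add_sub_cancel]
  ring

variable [Nonempty W]

/-- A nonempty sum of positive degrees is positive. [folklore] -/
private lemma sum_degF_pos' (degF : W → ℕ+) : (0 : ℝ) < ∑ w, (degF w : ℝ) :=
  Finset.sum_pos (fun w _ => by exact_mod_cast (degF w).pos) Finset.univ_nonempty

/-- **The normalized weights cancel the determinant exponent** ([IUTchIII] Rmk 3.1.1 (ii) p.94 with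
(iv) p.97 and Prop 3.9 (i) p.115). For summand-wise log-volume changes `t α w` contributed by the label
`α` in the field `K_w` (e.g. `t α w = c_{α,w} · log N𝔭_w` for the region `⊗_α ∏_w 𝔭_w^{-c_{α,w}}𝒪_w`), the
change of the Haar log-volume of the portion `⊗_α K_{wA α}` is `Σ_α (Π_{β≠α} n_{wA β}) · t α (wA α)`
(`n_w = degKF w · degF w = [K_w : ℚ_{v_ℚ}]`, determinant of `id ⊗ ⋯ ⊗ m_{x_α} ⊗ ⋯ ⊗ id`); weighting the
portions by the printed `packetWeightTensor` and summing gives EXACTLY the sum over `α ∈ A` of the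
single-packet weighted changes `Σ_w packetWeight w · t α w`: the `A`-capsule log-volume of a product of
`A` ideal-regions is additive over the labels, with no factor `(Σ_w degF w)^{|A|-1}`.
[claim: Mochizuki2012, status: disputed] -/
theorem sum_packetWeightTensor_mul_tensorDetChange (degF degKF : W → ℕ+) (t : A → W → ℝ) :
    ∑ wA : A → W, packetWeightTensor degF degKF wA *
        ∑ α, (∏ β ∈ univ.erase α, ((degKF (wA β) : ℝ) * (degF (wA β) : ℝ))) * t α (wA α) =
      ∑ α, ∑ w, packetWeight degF degKF w * t α w := by
  set D : ℝ := ∑ w, (degF w : ℝ) with hD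
  have hDpos : 0 < D := sum_degF_pos' degF
  have hS : (∑ w' : A → W, ∏ a, (degF (w' a) : ℝ)) = D ^ Fintype.card A :=
    sum_prod_degF_eq_pow degF
  -- distribute the weight over the sum in `α`, swap the sums, and cancel portion by portion
  simp_rw [Finset.mul_sum]
  rw [Finset.sum_comm]
  refine Finset.sum_congr rfl fun α _ => ?_
  simp_rw [packetWeightTensor_mul_prod_erase, hS]
  -- pull the `α`-independent denominator pieces out and use `sum_prod_erase_degF_mul`
  have hrew : ∀ wA : A → W,
      (∏ β ∈ univ.erase α, (degF (wA β) : ℝ)) * t α (wA α) /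
          ((degKF (wA α) : ℝ) * D ^ Fintype.card A) =
        (∏ β ∈ univ.erase α, (degF (wA β) : ℝ)) * (t α (wA α) / (degKF (wA α) : ℝ)) /
          D ^ Fintype.card A := by
    intro wA
    have hK : (degKF (wA α) : ℝ) ≠ 0 := pnat_cast_ne_zero (degKF (wA α))
    field_simp
  simp_rw [hrew, ← Finset.sum_div]
  rw [sum_prod_erase_degF_mul degF α (fun w => t α w / (degKF w : ℝ))]
  -- `D^{|A|-1} · X / D^{|A|} = X / D` since `A` is nonempty (`α ∈ A`)
  have hcard : Fintype.card A = (Fintype.card A - 1) + 1 :=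
    (Nat.sub_add_cancel (Fintype.card_pos_iff.mpr ⟨α⟩)).symm
  rw [hcard, pow_succ, Nat.add_sub_cancel]
  have hDne : D ≠ 0 := hDpos.ne'
  have hDk : D ^ (Fintype.card A - 1) ≠ 0 := pow_ne_zero _ hDne
  rw [Finset.mul_sum, Finset.sum_div]
  refine Finset.sum_congr rfl fun w _ => ?_
  have hK : (degKF w : ℝ) ≠ 0 := pnat_cast_ne_zero (degKF w)
  unfold packetWeight
  rw [← hD]
  field_simp

/-- **Packet-normalization of the `A`-capsule log-volume** ([IUTchIII] Prop 3.9 (i) p.115: for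
`μ^log_{A,v_ℚ}` as for `μ^log_{α,v_ℚ}`, "multiplication of an element of `𝕄(−)` by `p_v` corresponds to adding
the quantity `−log(p_v)`"): multiplying the region by `p_{v_ℚ}` acts on ONE label `α₀` (all the `1 ⊗ ⋯ ⊗ p ⊗ ⋯ ⊗ 1`
coincide in the tensor product over `ℚ_{v_ℚ}`), changing the Haar log-volume of `K_w` by `n_w · c`
(`c = −log p_{v_ℚ}` at a finite `v_ℚ`); the weighted `A`-capsule log-volume then changes by exactly `c` —
the same unit for every capsule size `|A|`. [claim: Mochizuki2012, status: disputed] -/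
theorem capsule_packetNormalized (degF degKF : W → ℕ+) (α₀ : A) (c : ℝ) :
    ∑ wA : A → W, packetWeightTensor degF degKF wA *
        ∑ α, (∏ β ∈ univ.erase α, ((degKF (wA β) : ℝ) * (degF (wA β) : ℝ))) *
          (if α = α₀ then ((degKF (wA α) : ℝ) * (degF (wA α) : ℝ)) * c else 0) = c := by
  rw [sum_packetWeightTensor_mul_tensorDetChange degF degKF
    (fun α w => if α = α₀ then ((degKF w : ℝ) * (degF w : ℝ)) * c else 0)]
  rw [Finset.sum_eq_single α₀ (fun α _ hα => by simp [hα]) (fun h => absurd (Finset.mem_univ α₀) h)]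
  simp only [if_true]
  exact packetWeight_normalized degF degKF c

end CapsuleAdditivity

end Literature.IUT.LogThetaLattice
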